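import Summits.HodgeConjecture.CorCM.IrreducibleOddWeightsHodgeGluingIntrinsicIff
import Summits.HodgeConjecture.CorCM.IrreducibleOddWeightsProductSpanBlocksMinimal
import HarnessLib

/-!
# THE HELLY NUMBER OF `Hg(X_1 × ⋯ × X_n) = ∏_j Hg(X_j)`, INTRINSIC FORM: for complex abelian varieties of CM type the
# identity holds IFF it holds for every sub-product of at most `max_j dim Hg(X_j) + 1` factors, and when it fails a
# MINIMAL failing sub-collection `S₀` has `|S₀| ≤ dim MT(H¹ X_j)` for every `j ∈ S₀` and carries the first exceptional
# mixed class

COR-CM (cell `pub-hodgecm2`, binder seat `b16` gen 61, count-neutral claim BLOCKS ARE MEMBERS, file H5 — complex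
abelian varieties of CM type, NO CM data in the statements; theorems only, no definition, no named fact, no `sorry`).
NEW as stated, hence under `Summits/`.  HONEST FRAMING: unconditional structure theorems on Mumford–Tate ranks and Hodge
classes of products of abelian varieties of CM type, and a reduction between instances of the Hodge conjecture (the
Hodge conjecture for powers of the factors is a HYPOTHESIS); `HC_CM` is neither used nor asserted.

`X : Fin n → AbelianVariety ℂ` of CM type (`Milne1999.IsOfCMType`) and positive dimension; `t(Y) = dim MT(H¹(Y, ℚ))`
(the tree's `HodgeStructure.mtRank` of `BettiUniverse.hodge … 1`, ANY smooth-projective witness); for `S ⊆ Fin n`,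
`X_S = ⨁_{j ∈ S} X_j`.  Always `t(X_S) + |S| ≤ Σ_{j ∈ S} t(X_j) + 1` (`Hg(X_S) ⊆ ∏_S Hg(X_j)`), with equality iff
`Hg(X_S) = ∏_{j ∈ S} Hg(X_j)` (`MT = 𝔾_m · Hg`).  Milne's regrouping writes each `X_j` as a product of CM realisations up
to isogeny; the glued family, partitioned by `j`, has block ranks `t(X_j)` and, over every set of blocks `S`, the rank
`t(X_S)` (`mtRank_hodge_one_eq_cmFamilyRank_of_isIsogenous_biproduct`).  So the BLOCK theorems of files H2/H3
(`IrreducibleOddWeightsBlockHellyCMFields`, `IrreducibleOddWeightsProductSpanBlocksMinimal`) read intrinsically: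

* **`mtRank_add_card_eq_iff_forall_card_le_of_mtRank_le`** — if `t(X_j) ≤ q + 1` for all `j` (`dim Hg(X_j) ≤ q`; e.g.
  `dim X_j ≤ q`, `…_of_dim_le`), then `t(⨁ X) + n = Σ_j t(X_j) + 1` IFF `t(X_S) + |S| = Σ_{j ∈ S} t(X_j) + 1` for every
  non-empty `S` with `|S| ≤ q + 1` (and every smooth-projective witness): `Hg(∏_j X_j) = ∏_j Hg(X_j)` iff so on all
  sub-products of at most `q + 1` factors.  CM elliptic curves: PAIRS; abelian surfaces of CM type: TRIPLES; …
* **`hodgeConjectureFor_biproduct_of_forall_card_le_of_mtRank_le`** — under the same Helly hypothesis, the Hodge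
  conjecture for the powers `X_j^{N+1}` implies the Hodge conjecture for every product of copies `⨁_k X_{π k}`.
* **`exists_minimal_not_hodgeClassesProductSpan_of_mtRank_add_card_ne`** — if `t(⨁ X) + n ≠ Σ_j t(X_j) + 1`
  (`Hg(∏ X_j) ⊊ ∏ Hg(X_j)`) there are `S₀ ⊆ Fin n` and `j₀ ∈ S₀` with: `S₀` fails the identity, every non-empty proper
  `S ⊂ S₀` satisfies it, `|S₀| ≤ t(X_j)` for EVERY `j ∈ S₀`, and for some `N₁, N₂ ≥ 1` and `π₂ : Fin N₂ → S₀ ∖ {j₀}` the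
  product `X_{j₀}^{N₁} × ∏_k X_{π₂ k}` carries a rational Hodge class which is NOT a `ℂ`-combination of exterior products
  of Hodge classes of the two factors — an exceptional class needing `m` of the factors needs `dim Hg(X_j) ≥ m − 1` of
  each; `exists_card_le_not_hodgeClassesProductSpan_of_mtRank_le` (`≤ q + 1` factors), `…_of_dim_le`.

Gen 60's G6/G9 are the case "all of `Fin n` at once"; gen 59/60 had the Helly and minimal statements only for CM-typed
families `A_i ⊨ (K_i; Φ_i)`.

## References

* [MoonenZarhin1999LowDim] B. Moonen, Yu. Zarhin, *Hodge classes on abelian varieties of low dimension*, Math. Ann.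
  315 (1999), §2 (`MT = 𝔾_m · Hg`) and §3 (3.1), Remark (3.9).
* [Mai1989] L. Mai, *Lower bounds for the ranks of CM types*, J. Number Theory 32 (1989), §2 Prop. 1 (proof).
* [Gordon1999HodgeAVSurvey] B. B. Gordon, *A survey of the Hodge conjecture for abelian varieties*, §3 Theorem (Imai,
  Murty) with proof; 7.4–7.7; 9.1.
* [Milne1999LefschetzClasses] J. S. Milne, *Lefschetz classes on abelian varieties*, Duke Math. J. 96 (1999), §1
  Prop. 1.1.
* [Deligne1982HodgeCycles] P. Deligne, *Hodge cycles on abelian varieties*, LNM 900 (1982), I Ex. 3.7 (c).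
* [vanGeemen1994HodgeAV] B. van Geemen, LNM 1594 (1994), §3.5–3.7 Lemma 3.7.
* [MumfordAV1970] D. Mumford, *Abelian Varieties* (1970), §19.
-/

set_option autoImplicit false

noncomputable section

open scoped BigOperators

open CategoryTheory CategoryTheory.Limits NumberField

namespace Summit.HodgeConjecture.CorCM

open Literature.NumberTheory.ComplexMultiplication
open Literature.AlgebraicGeometry.Motives
open Literature.AlgebraicGeometry.Motives.AbelianVariety
open Literature.AlgebraicGeometry.HodgeTheory
open Literature.AlgebraicGeometry.ComplexMultiplication (IsCMTypeRealisation)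
open Literature.AlgebraicGeometry.Milne1999 (IsOfCMType exists_isIsogeny_to_biproduct_of_classes_of_isOfCMType)
open Literature.AlgebraicGeometry.Pohlmann1968

section Intrinsic

variable [HodgeTensorFacts.{0, 0}]

/-- **THE DICTIONARY.**  For `X : Fin n → AbelianVariety ℂ` of CM type and positive dimension there is a glued family of
CM realisations `A'_x ⊨ (K'_x; Φ'_x)` (`x ∈ I'` finite non-empty) with a partition `κ : I' ↠ Fin n` such that: the
Mumford–Tate rank of `H¹` of every sub-product `⨁_{j ∈ S} X_j` (any witness) is `cmFamilyRank Φ'|_{κ ∈ S}`, that of every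
`X_j` is the block rank `cmFamilyRank Φ'|_{κ = j}`, that of `⨁ X` is `cmFamilyRank Φ'`; and the product-span property
descends from products of copies of the `X_{κ x}` to products of copies of the `A'_x` (retracts up to isogeny).
(Milne's regrouping of each `X_j`, Künneth in degree one, Deligne's Ex. 3.7 (c), isogeny invariance.)
[cite: Milne1999LefschetzClasses, §1 Prop. 1.1 (p. 643)] [cite: Deligne1982HodgeCycles, I Ex. 3.7 (c)]
[cite: MoonenZarhin1999LowDim, §2 and §3 (3.1)] [cite: MumfordAV1970, §19] -/
theorem exists_glued_family_mtRank_eq_cmFamilyRank {n : ℕ} [NeZero n] (X : Fin n → AbelianVariety ℂ)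
    (hX0 : ∀ j, 0 < (X j).dim) (hcm : ∀ j, IsOfCMType (X j)) {kX : Fin n → ℕ}
    (hX : ∀ j, IsSmoothProjective (kX j) (X j).X) {kP : ℕ} (hP : IsSmoothProjective kP (⨁ X).X) :
    ∃ (I' : Type) (_ : Fintype I') (_ : Nonempty I') (K' : I' → Type) (_ : ∀ x, Field (K' x))
      (_ : ∀ x, NumberField (K' x)) (_ : ∀ x, IsCMField (K' x)) (Φ' : ∀ x, CMType (K' x)) (A' : I' → AbelianVariety ℂ)
      (ι' : ∀ x, 𝓞 (K' x) →+* End (A' x)) (θ' : ∀ x, K' x →+* Module.End ℂ (complexBetti (A' x).X 1))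
      (κ : I' → Fin n),
      (∀ x, IsCMTypeRealisation (Φ' x) (A' x) (ι' x) (θ' x)) ∧ Function.Surjective κ ∧
      (haveI := BettiUniverse.finite hP 1
      (BettiUniverse.hodge exists_isReal_hodgeModel_holds hP 1).mtRank = CMAlgebra.cmFamilyRank Φ') ∧
      (∀ j, haveI := BettiUniverse.finite (hX j) 1
        (BettiUniverse.hodge exists_isReal_hodgeModel_holds (hX j) 1).mtRank =
          CMAlgebra.cmFamilyRank fun x : {x // κ x = j} => Φ' x.1) ∧
      (∀ (S : Finset (Fin n)), S.Nonempty → ∀ {kS : ℕ}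
        (hS : IsSmoothProjective kS (⨁ fun j : {j // j ∈ S} => X j.1).X),
        haveI := BettiUniverse.finite hS 1
        (BettiUniverse.hodge exists_isReal_hodgeModel_holds hS 1).mtRank =
          CMAlgebra.cmFamilyRank fun x : {x // κ x ∈ S} => Φ' x.1) ∧
      ∀ (N₁ N₂ : ℕ) (π₁ : Fin N₁ → I') (π₂ : Fin N₂ → I'),
        HodgeClassesProductSpan (⨁ fun k => X (κ (π₁ k))) (⨁ fun k => X (κ (π₂ k))) →
          HodgeClassesProductSpan (⨁ fun k => A' (π₁ k)) (⨁ fun k => A' (π₂ k)) := by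
  classical
  -- Milne's regrouping of every factor, and the glued family `(j, i) ↦ A j (cls j i)` (as in G6/G9)
  choose C instC K instF instNF instCM Φ A ι θ m cls f hA _h1 _h2 hf using
    fun j => exists_isIsogeny_to_biproduct_of_classes_of_isOfCMType (hX0 j) (hcm j)
  let I' : Type := Σ j : Fin n, Fin (m j + 1)
  let K' : I' → Type := fun x => K x.1 (cls x.1 x.2)
  letI : ∀ x : I', Field (K' x) := fun x => instF x.1 (cls x.1 x.2)
  letI : ∀ x : I', NumberField (K' x) := fun x => instNF x.1 (cls x.1 x.2)
  haveI : ∀ x : I', IsCMField (K' x) := fun x => instCM x.1 (cls x.1 x.2)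
  let Φ' : ∀ x : I', CMType (K' x) := fun x => Φ x.1 (cls x.1 x.2)
  let A' : I' → AbelianVariety ℂ := fun x => A x.1 (cls x.1 x.2)
  have hA' : ∀ x : I', IsCMTypeRealisation (Φ' x) (A' x) (ι x.1 (cls x.1 x.2)) (θ x.1 (cls x.1 x.2)) :=
    fun x => hA x.1 (cls x.1 x.2)
  have hκ : Function.Surjective (fun x : I' => x.1) := fun j => ⟨⟨j, 0⟩, rfl⟩
  have hXj : ∀ j, IsIsogenous (X j) (⨁ fun i : Fin (m j + 1) => A j (cls j i)) := fun j => ⟨f j, hf j⟩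
  have hPB : IsIsogenous (⨁ X) (⨁ fun x : I' => A' x) :=
    (IsIsogenous.biproduct hXj).trans (isIsogenous_biproduct_biproduct_sigma fun j i => A j (cls j i))
  refine ⟨I', inferInstance, ⟨⟨0, 0⟩⟩, K', inferInstance, inferInstance, inferInstance, Φ', A',
    fun x => ι x.1 (cls x.1 x.2), fun x => θ x.1 (cls x.1 x.2), fun x => x.1, hA', hκ, ?_, fun j => ?_,
    fun S hS {kS} hSw => ?_, fun N₁ N₂ π₁ π₂ h => ?_⟩
  · -- the full product
    exact mtRank_hodge_one_eq_cmFamilyRank_of_isIsogenous_biproduct (cls := fun x : I' => x) hA'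
      Function.surjective_id hP hPB
  · -- one factor = one block
    have hrankX : haveI := BettiUniverse.finite (hX j) 1
        (BettiUniverse.hodge exists_isReal_hodgeModel_holds (hX j) 1).mtRank =
          CMAlgebra.cmFamilyRank fun i : Fin (m j + 1) => Φ j (cls j i) :=
      mtRank_hodge_one_eq_cmFamilyRank_of_isIsogenous_biproduct (cls := fun i : Fin (m j + 1) => i)
        (fun i => hA j (cls j i)) Function.surjective_id (hX j) (hXj j)
    have hsurj : Function.Surjective fun i : Fin (m j + 1) => (⟨⟨j, i⟩, rfl⟩ : {x : I' // x.1 = j}) := by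
      rintro ⟨⟨j', i⟩, h⟩
      change j' = j at h
      subst h
      exact ⟨i, rfl⟩
    rw [hrankX]
    exact CMAlgebra.cmFamilyRank_comp_of_surjective (fun x : {x : I' // x.1 = j} => Φ' x.1) hsurj
  · -- a set of blocks = a sub-product
    obtain ⟨j₁, hj₁⟩ := hS
    let J : Type := Σ j : {j // j ∈ S}, Fin (m j.1 + 1)
    have hclsS : Function.Surjective fun y : J => (⟨⟨y.1.1, y.2⟩, y.1.2⟩ : {x : I' // x.1 ∈ S}) := by
      rintro ⟨⟨j, i⟩, hj⟩
      exact ⟨⟨⟨j, hj⟩, i⟩, rfl⟩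
    have hXSB : IsIsogenous (⨁ fun j : {j // j ∈ S} => X j.1)
        (⨁ fun y : J => A' (⟨⟨y.1.1, y.2⟩, y.1.2⟩ : {x : I' // x.1 ∈ S}).1) :=
      (IsIsogenous.biproduct fun j : {j // j ∈ S} => hXj j.1).trans
        (isIsogenous_biproduct_biproduct_sigma fun (j : {j // j ∈ S}) (i : Fin (m j.1 + 1)) => A j.1 (cls j.1 i))
    exact mtRank_hodge_one_eq_cmFamilyRank_of_isIsogenous_biproduct (Φ' := fun x : {x : I' // x.1 ∈ S} => Φ' x.1)
      (A' := fun x : {x : I' // x.1 ∈ S} => A' x.1) (fun x => hA' x.1) hclsS hSw hXSB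
  · -- retracts
    have hfull : HodgeClassesProductSpan
        (⨁ fun k => ⨁ fun i : Fin (m (π₁ k).1 + 1) => A (π₁ k).1 (cls (π₁ k).1 i))
        (⨁ fun k => ⨁ fun i : Fin (m (π₂ k).1 + 1) => A (π₂ k).1 (cls (π₂ k).1 i)) :=
      h.of_isIsogenous' (IsIsogenous.biproduct fun k => hXj (π₁ k).1) (IsIsogenous.biproduct fun k => hXj (π₂ k).1)
    exact hodgeClassesProductSpan_biproduct_apply_of_biproduct_biproduct (fun j i => A j (cls j i))
      (fun k => (π₁ k).1) (fun k => (π₁ k).2) (fun k => (π₂ k).1) (fun k => (π₂ k).2) hfull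

/-- **THE HELLY NUMBER OF `Hg(∏_j X_j) = ∏_j Hg(X_j)` FOR ABELIAN VARIETIES OF CM TYPE.**  `X : Fin n → AbelianVariety ℂ`
of CM type and positive dimension, `t(Y) = dim MT(H¹(Y))` (any smooth-projective witnesses), and `q` with
`t(X_j) ≤ q + 1` for all `j` (`dim Hg(X_j) ≤ q`).  Then `t(⨁ X) + n = Σ_j t(X_j) + 1` — `Hg(∏_j X_j) = ∏_j Hg(X_j)` — IF AND
ONLY IF for every non-empty `S ⊆ Fin n` with `|S| ≤ q + 1` (and every witness) `t(⨁_{j ∈ S} X_j) + |S| = Σ_{j ∈ S} t(X_j) + 1`: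
the identity is decided on sub-products of at most `q + 1` factors.  No CM data in the statement.
[cite: MoonenZarhin1999LowDim, §2 and §3 (3.1)] [cite: Mai1989, §2 Prop. 1 (proof)] [cite: Gordon1999HodgeAVSurvey, 7.7 and 9.1]
[cite: Deligne1982HodgeCycles, I Ex. 3.7 (c)] -/
theorem mtRank_add_card_eq_iff_forall_card_le_of_mtRank_le {n : ℕ} [NeZero n] (X : Fin n → AbelianVariety ℂ)
    (hX0 : ∀ j, 0 < (X j).dim) (hcm : ∀ j, IsOfCMType (X j)) {kX : Fin n → ℕ}
    (hX : ∀ j, IsSmoothProjective (kX j) (X j).X) {kP : ℕ} (hP : IsSmoothProjective kP (⨁ X).X) (q : ℕ)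
    (hq : ∀ j, haveI := BettiUniverse.finite (hX j) 1
      (BettiUniverse.hodge exists_isReal_hodgeModel_holds (hX j) 1).mtRank ≤ q + 1) :
    (   haveI := BettiUniverse.finite hP 1
        haveI := fun j => BettiUniverse.finite (hX j) 1
      (BettiUniverse.hodge exists_isReal_hodgeModel_holds hP 1).mtRank + n =
        (∑ j, (BettiUniverse.hodge exists_isReal_hodgeModel_holds (hX j) 1).mtRank) + 1) ↔
    ∀ (S : Finset (Fin n)), S.Nonempty → S.card ≤ q + 1 → ∀ {kS : ℕ}
      (hS : IsSmoothProjective kS (⨁ fun j : {j // j ∈ S} => X j.1).X),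
        haveI := BettiUniverse.finite hS 1
        haveI := fun j => BettiUniverse.finite (hX j) 1
        (BettiUniverse.hodge exists_isReal_hodgeModel_holds hS 1).mtRank + S.card =
          (∑ j ∈ S, (BettiUniverse.hodge exists_isReal_hodgeModel_holds (hX j) 1).mtRank) + 1 := by
  classical
  obtain ⟨I', _, _, K', _, _, _, Φ', A', ι', θ', κ, hA', hκ, hrankP, hrankX, hrankS, -⟩ :=
    exists_glued_family_mtRank_eq_cmFamilyRank X hX0 hcm hX hP
  have hq' : ∀ j, CMAlgebra.cmFamilyRank (fun x : {x // κ x = j} => Φ' x.1) ≤ q + 1 := fun j => by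
    rw [← hrankX j]
    exact hq j
  have key := cmFamilyRank_fiber_add_card_eq_iff_forall_card_le_of_cmFamilyRank_le Φ' κ hκ q hq'
  rw [Fintype.card_fin] at key
  rw [hrankP, Finset.sum_congr rfl fun j _ => hrankX j, key]
  refine forall_congr' fun S => forall_congr' fun hSne => forall_congr' fun _ => ?_
  rw [Finset.sum_congr rfl fun j _ => hrankX j]
  constructor
  · intro H kS hS
    rw [hrankS S hSne hS]
    exact H
  · intro H
    rw [← hrankS S hSne isSmoothProjective_holds]
    exact H isSmoothProjective_holds

/-- **`dim X_j ≤ q` for all `j` suffices** (`t(X_j) ≤ dim X_j + 1` for CM type): `Hg(∏_j X_j) = ∏_j Hg(X_j)` iff so on all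
sub-products of at most `q + 1` factors — CM elliptic curves PAIRS, CM surfaces TRIPLES, CM threefolds QUADRUPLES.
[cite: Gordon1999HodgeAVSurvey, 7.4 and 7.7] [cite: MoonenZarhin1999LowDim, §3 (3.1)] -/
theorem mtRank_add_card_eq_iff_forall_card_le_of_dim_le {n : ℕ} [NeZero n] (X : Fin n → AbelianVariety ℂ)
    (hX0 : ∀ j, 0 < (X j).dim) (hcm : ∀ j, IsOfCMType (X j)) {kX : Fin n → ℕ}
    (hX : ∀ j, IsSmoothProjective (kX j) (X j).X) {kP : ℕ} (hP : IsSmoothProjective kP (⨁ X).X) (q : ℕ)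
    (hq : ∀ j, (X j).dim ≤ q) :
    (   haveI := BettiUniverse.finite hP 1
        haveI := fun j => BettiUniverse.finite (hX j) 1
      (BettiUniverse.hodge exists_isReal_hodgeModel_holds hP 1).mtRank + n =
        (∑ j, (BettiUniverse.hodge exists_isReal_hodgeModel_holds (hX j) 1).mtRank) + 1) ↔
    ∀ (S : Finset (Fin n)), S.Nonempty → S.card ≤ q + 1 → ∀ {kS : ℕ}
      (hS : IsSmoothProjective kS (⨁ fun j : {j // j ∈ S} => X j.1).X),
        haveI := BettiUniverse.finite hS 1
        haveI := fun j => BettiUniverse.finite (hX j) 1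
        (BettiUniverse.hodge exists_isReal_hodgeModel_holds hS 1).mtRank + S.card =
          (∑ j ∈ S, (BettiUniverse.hodge exists_isReal_hodgeModel_holds (hX j) 1).mtRank) + 1 :=
  mtRank_add_card_eq_iff_forall_card_le_of_mtRank_le X hX0 hcm hX hP q fun j =>
    (mtRank_hodge_one_le_dim_add_one_of_isOfCMType (hX j) (hX0 j) (hcm j)).trans (Nat.add_le_add_right (hq j) 1)

/-- **HODGE GLUING, INTRINSIC HELLY FORM.**  `X : Fin n → AbelianVariety ℂ` of CM type and positive dimension with
`t(X_j) ≤ q + 1` for all `j`.  IF `t(⨁_{j ∈ S} X_j) + |S| = Σ_{j ∈ S} t(X_j) + 1` (`Hg(∏_S X_j) = ∏_S Hg(X_j)`) for every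
non-empty `S` with `|S| ≤ q + 1` and the Hodge conjecture holds for every power `X_j^{N+1}`, THEN the Hodge conjecture
holds for every product of copies `⨁_{k ∈ J} X_{π k}`. [cite: MoonenZarhin1999LowDim, §3 (3.1)]
[cite: Mai1989, §2 Prop. 1 (proof)] [cite: vanGeemen1994HodgeAV, §3.5–3.7 Lemma 3.7 (p. 236)] [cite: Milne1999LefschetzClasses, §1 Prop. 1.1 (p. 643)] -/
theorem hodgeConjectureFor_biproduct_of_forall_card_le_of_mtRank_le {n : ℕ} [NeZero n]
    (X : Fin n → AbelianVariety ℂ) (hX0 : ∀ j, 0 < (X j).dim) (hcm : ∀ j, IsOfCMType (X j)) {kX : Fin n → ℕ}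
    (hX : ∀ j, IsSmoothProjective (kX j) (X j).X) (q : ℕ)
    (hq : ∀ j, haveI := BettiUniverse.finite (hX j) 1
      (BettiUniverse.hodge exists_isReal_hodgeModel_holds (hX j) 1).mtRank ≤ q + 1)
    (hS : ∀ (S : Finset (Fin n)), S.Nonempty → S.card ≤ q + 1 → ∀ {kS : ℕ}
      (hS : IsSmoothProjective kS (⨁ fun j : {j // j ∈ S} => X j.1).X),
        haveI := BettiUniverse.finite hS 1
        haveI := fun j => BettiUniverse.finite (hX j) 1
        (BettiUniverse.hodge exists_isReal_hodgeModel_holds hS 1).mtRank + S.card =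
          (∑ j ∈ S, (BettiUniverse.hodge exists_isReal_hodgeModel_holds (hX j) 1).mtRank) + 1)
    (hHC : ∀ (j : Fin n) (N : ℕ), HodgeConjectureFor ((X j).powSucc N).dim ((X j).powSucc N).X)
    {J : Type} [Fintype J] [Nonempty J] (π : J → Fin n) :
    HodgeConjectureFor (⨁ fun k => X (π k)).dim (⨁ fun k => X (π k)).X :=
  hodgeConjectureFor_biproduct_of_mtRank_add_card_eq X hX0 hcm hX isSmoothProjective_holds
    ((mtRank_add_card_eq_iff_forall_card_le_of_mtRank_le X hX0 hcm hX isSmoothProjective_holds q hq).2 hS) hHC π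

/-- **WHERE THE FIRST EXCEPTIONAL MIXED CLASS LIVES, INTRINSIC FORM.**  `X : Fin n → AbelianVariety ℂ` of CM type and
positive dimension with `t(⨁ X) + n ≠ Σ_j t(X_j) + 1` (`Hg(∏_j X_j) ⊊ ∏_j Hg(X_j)`).  Then there are `S₀ ⊆ Fin n` and
`j₀ ∈ S₀` such that: `t(⨁_{S₀} X_j) + |S₀| ≠ Σ_{S₀} t(X_j) + 1` while `t(⨁_S X_j) + |S| = Σ_S t(X_j) + 1` for every non-empty
proper `S ⊂ S₀` (any witnesses); `|S₀| ≤ t(X_j) = dim MT(H¹ X_j)` for EVERY `j ∈ S₀`; and for some `N₁, N₂ ≥ 1` and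
`π₂ : Fin N₂ → Fin n` with values in `S₀ ∖ {j₀}`, the product `X_{j₀}^{N₁} × ∏_k X_{π₂ k}` carries a rational Hodge class that
is NOT a `ℂ`-combination of exterior products of rational Hodge classes of `X_{j₀}^{N₁}` and `∏_k X_{π₂ k}`.
[cite: MoonenZarhin1999LowDim, §3 (3.1)] [cite: Mai1989, §2 Prop. 1 (proof)] [cite: Gordon1999HodgeAVSurvey, 7.5–7.7 and 9.1]
[cite: Milne1999LefschetzClasses, §1 Prop. 1.1 (p. 643)] -/
theorem exists_minimal_not_hodgeClassesProductSpan_of_mtRank_add_card_ne {n : ℕ} [NeZero n]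
    (X : Fin n → AbelianVariety ℂ) (hX0 : ∀ j, 0 < (X j).dim) (hcm : ∀ j, IsOfCMType (X j)) {kX : Fin n → ℕ}
    (hX : ∀ j, IsSmoothProjective (kX j) (X j).X) {kP : ℕ} (hP : IsSmoothProjective kP (⨁ X).X)
    (hne : haveI := BettiUniverse.finite hP 1
      haveI := fun j => BettiUniverse.finite (hX j) 1
      (BettiUniverse.hodge exists_isReal_hodgeModel_holds hP 1).mtRank + n ≠
        (∑ j, (BettiUniverse.hodge exists_isReal_hodgeModel_holds (hX j) 1).mtRank) + 1) :
    ∃ (S₀ : Finset (Fin n)) (j₀ : Fin n), j₀ ∈ S₀ ∧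
      (∀ {kS : ℕ} (hS : IsSmoothProjective kS (⨁ fun j : {j // j ∈ S₀} => X j.1).X),
        haveI := BettiUniverse.finite hS 1
        haveI := fun j => BettiUniverse.finite (hX j) 1
        (BettiUniverse.hodge exists_isReal_hodgeModel_holds hS 1).mtRank + S₀.card ≠
          (∑ j ∈ S₀, (BettiUniverse.hodge exists_isReal_hodgeModel_holds (hX j) 1).mtRank) + 1) ∧
      (∀ S : Finset (Fin n), S ⊂ S₀ → S.Nonempty → ∀ {kS : ℕ}
        (hS : IsSmoothProjective kS (⨁ fun j : {j // j ∈ S} => X j.1).X),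
        haveI := BettiUniverse.finite hS 1
        haveI := fun j => BettiUniverse.finite (hX j) 1
        (BettiUniverse.hodge exists_isReal_hodgeModel_holds hS 1).mtRank + S.card =
          (∑ j ∈ S, (BettiUniverse.hodge exists_isReal_hodgeModel_holds (hX j) 1).mtRank) + 1) ∧
      (∀ j ∈ S₀, haveI := BettiUniverse.finite (hX j) 1
        S₀.card ≤ (BettiUniverse.hodge exists_isReal_hodgeModel_holds (hX j) 1).mtRank) ∧
      ∃ (N₁ N₂ : ℕ) (_ : NeZero N₁) (_ : NeZero N₂) (π₂ : Fin N₂ → Fin n),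
        (∀ k, π₂ k ∈ S₀.erase j₀) ∧
          ¬ HodgeClassesProductSpan (⨁ fun _ : Fin N₁ => X j₀) (⨁ fun k => X (π₂ k)) := by
  classical
  obtain ⟨I', _, _, K', _, _, _, Φ', A', ι', θ', κ, hA', hκ, hrankP, hrankX, hrankS, hspan⟩ :=
    exists_glued_family_mtRank_eq_cmFamilyRank X hX0 hcm hX hP
  -- the failure is the failure of block additivity of the glued family
  have hne' : CMAlgebra.cmFamilyRank Φ' + Fintype.card (Fin n) ≠
      (∑ c, CMAlgebra.cmFamilyRank fun x : {x // κ x = c} => Φ' x.1) + 1 := by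
    rw [Fintype.card_fin, ← hrankP, Finset.sum_congr rfl fun j _ => (hrankX j).symm]
    exact hne
  obtain ⟨C₀, c₀, hc₀, hC₀, hmin, hcard, N₁, N₂, hN₁, hN₂, π₁, π₂, h₁, h₂, hnot⟩ :=
    exists_minimal_not_hodgeClassesProductSpan_of_cmFamilyRank_fiber_add_card_ne κ hκ hA' hne'
  have hC₀ne : C₀.Nonempty := ⟨c₀, hc₀⟩
  refine ⟨C₀, c₀, hc₀, fun {kS} hS => ?_, fun S hS hSne {kS} hSw => ?_, fun j hj => ?_, N₁, N₂, hN₁, hN₂,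
    fun k => κ (π₂ k), h₂, fun h => hnot (hspan N₁ N₂ π₁ π₂ ?_)⟩
  · rw [hrankS C₀ hC₀ne hS, Finset.sum_congr rfl fun j _ => hrankX j]
    exact hC₀
  · rw [hrankS S hSne hSw, Finset.sum_congr rfl fun j _ => hrankX j]
    exact hmin S hS hSne
  · rw [hrankX j]
    exact hcard j hj
  · have hfun : (fun k => X (κ (π₁ k))) = fun _ : Fin N₁ => X c₀ := funext fun k => by rw [h₁ k]
    rw [hfun]
    exact h

/-- **`t(X_j) ≤ q + 1` for all `j` ⟹ the first exceptional mixed class lives on at most `q + 1` of the factors.**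
[cite: MoonenZarhin1999LowDim, §3 (3.1)] [cite: Mai1989, §2 Prop. 1 (proof)] -/
theorem exists_card_le_not_hodgeClassesProductSpan_of_mtRank_le {n : ℕ} [NeZero n]
    (X : Fin n → AbelianVariety ℂ) (hX0 : ∀ j, 0 < (X j).dim) (hcm : ∀ j, IsOfCMType (X j)) {kX : Fin n → ℕ}
    (hX : ∀ j, IsSmoothProjective (kX j) (X j).X) {kP : ℕ} (hP : IsSmoothProjective kP (⨁ X).X) (q : ℕ)
    (hq : ∀ j, haveI := BettiUniverse.finite (hX j) 1
      (BettiUniverse.hodge exists_isReal_hodgeModel_holds (hX j) 1).mtRank ≤ q + 1)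
    (hne : haveI := BettiUniverse.finite hP 1
      haveI := fun j => BettiUniverse.finite (hX j) 1
      (BettiUniverse.hodge exists_isReal_hodgeModel_holds hP 1).mtRank + n ≠
        (∑ j, (BettiUniverse.hodge exists_isReal_hodgeModel_holds (hX j) 1).mtRank) + 1) :
    ∃ (S₀ : Finset (Fin n)) (j₀ : Fin n), j₀ ∈ S₀ ∧ S₀.card ≤ q + 1 ∧
      ∃ (N₁ N₂ : ℕ) (_ : NeZero N₁) (_ : NeZero N₂) (π₂ : Fin N₂ → Fin n),
        (∀ k, π₂ k ∈ S₀.erase j₀) ∧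
          ¬ HodgeClassesProductSpan (⨁ fun _ : Fin N₁ => X j₀) (⨁ fun k => X (π₂ k)) := by
  obtain ⟨S₀, j₀, hj₀, -, -, hcard, N₁, N₂, hN₁, hN₂, π₂, hπ₂, hnot⟩ :=
    exists_minimal_not_hodgeClassesProductSpan_of_mtRank_add_card_ne X hX0 hcm hX hP hne
  exact ⟨S₀, j₀, hj₀, (hcard j₀ hj₀).trans (hq j₀), N₁, N₂, hN₁, hN₂, π₂, hπ₂, hnot⟩

/-- **`dim X_j ≤ q` for all `j` ⟹ the first exceptional mixed class lives on at most `q + 1` of the factors** (CM elliptic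
curves: a PAIR `X_i^{a} × X_j^{b}`; CM surfaces: at most three factors; …). [cite: MoonenZarhin1999LowDim, §3 (3.1)]
[cite: Gordon1999HodgeAVSurvey, §3 Theorem and 7.4–7.7] -/
theorem exists_card_le_not_hodgeClassesProductSpan_of_dim_le {n : ℕ} [NeZero n]
    (X : Fin n → AbelianVariety ℂ) (hX0 : ∀ j, 0 < (X j).dim) (hcm : ∀ j, IsOfCMType (X j)) {kX : Fin n → ℕ}
    (hX : ∀ j, IsSmoothProjective (kX j) (X j).X) {kP : ℕ} (hP : IsSmoothProjective kP (⨁ X).X) (q : ℕ)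
    (hq : ∀ j, (X j).dim ≤ q)
    (hne : haveI := BettiUniverse.finite hP 1
      haveI := fun j => BettiUniverse.finite (hX j) 1
      (BettiUniverse.hodge exists_isReal_hodgeModel_holds hP 1).mtRank + n ≠
        (∑ j, (BettiUniverse.hodge exists_isReal_hodgeModel_holds (hX j) 1).mtRank) + 1) :
    ∃ (S₀ : Finset (Fin n)) (j₀ : Fin n), j₀ ∈ S₀ ∧ S₀.card ≤ q + 1 ∧
      ∃ (N₁ N₂ : ℕ) (_ : NeZero N₁) (_ : NeZero N₂) (π₂ : Fin N₂ → Fin n),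
        (∀ k, π₂ k ∈ S₀.erase j₀) ∧
          ¬ HodgeClassesProductSpan (⨁ fun _ : Fin N₁ => X j₀) (⨁ fun k => X (π₂ k)) :=
  exists_card_le_not_hodgeClassesProductSpan_of_mtRank_le X hX0 hcm hX hP q (fun j =>
    (mtRank_hodge_one_le_dim_add_one_of_isOfCMType (hX j) (hX0 j) (hcm j)).trans (Nat.add_le_add_right (hq j) 1)) hne

end Intrinsic

end Summit.HodgeConjecture.CorCM

end
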